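import Summits.AtomisticToContinuum.FouriersLaw.Theorems.OddSectorIrreversibilityTapLeakBoundFloorWindow

/-!
# `TapLeakBound` (stmt-AtomisticToContinuum-15159), line `SketchIdeator2`, floor of `stub_kickCone`: the `m₀`-window arithmetic

Helper file (`--supports stmt-AtomisticToContinuum-15159`) for crux
P = `Summit.AtomisticToContinuum.FouriersLaw.Theses.OddSectorIrreversibility.TapLeakBound`, registered stub `stub_kickCone`
(C′ `ResampledKickCone`). The first floor program (file `…TapLeakBoundFloorWindow`) truncates the energy at the box scale
`R = (1+d)^{1/4}` and works in the window `s⁴ ≤ a (1+d)³`; the SECOND floor program takes an arbitrary moment order `m₀ ≥ 1`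
and the box scale `R = (1+d)^{1/(4m₀)}` (site-energy cap `E = lam R⁴/4`), in the wider window `s^{4m₀} ≤ a (1+d)^{4m₀-1}`
(`a = ((64 A)^{4m₀})⁻¹`), i.e. `s ≲ d^{1 - 1/(4m₀)}`. This file holds the elementary real arithmetic of that choice
(`Real.rpow` with exponent `(4m₀)⁻¹` and natural powers), with no measure theory:

* `one_le_rpow_window`, `rpow_window_pow`, `rpow_window_pow_le` — the box scale `R = (1+d)^{(4m₀)⁻¹}`: `R ≥ 1`,
  `R^{4m₀} = 1+d`, `Rᵏ ≤ 1+d` for `k ≤ 4m₀`;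
* `supWindow_of_pow_le` — the window: `s^{4m₀} ≤ ((64A)^{4m₀})⁻¹ (1+d)^{4m₀-1}` with `A ≥ 1`, `d ≥ 1`, `s ≥ 0` forces
  `32·A·R·s ≤ d` (and `s ≤ 1+d`): `(64 A R s)^{4m₀} = (64 A s)^{4m₀} (1+d) ≤ (1+d)^{4m₀} ≤ (2d)^{4m₀}`;
* `tail_pow_eight_mul_eq` — the Markov factor of the bad event at cap `E = lam R⁴/4`:
  `(2/E)^{8m₀} = (8/lam)^{8m₀} (1+d)^{-8}` (`(R⁴)^{8m₀} = (R^{4m₀})⁸ = (1+d)⁸`);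
* `stub_floorSupWindow` — the registered closed `∀`-form of `supWindow_of_pow_le`.

References: folklore. Nothing here closes the item.
-/

noncomputable section

open MeasureTheory ProbabilityTheory Filter Topology Set Function
open scoped NNReal ENNReal

namespace Summit.AtomisticToContinuum.FouriersLaw.Theorems.OddSectorIrreversibility.TapLeak

/-! ### The box scale `R = (1+d)^{1/(4m₀)}` -/

/-- `1 ≤ (1+d)^{(4m₀)⁻¹}`. [folklore] -/
theorem one_le_rpow_window (m₀ d : ℕ) : 1 ≤ (1 + (d : ℝ)) ^ ((4 * (m₀ : ℝ))⁻¹) := by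
  refine Real.one_le_rpow ?_ (by positivity)
  have : (0 : ℝ) ≤ d := Nat.cast_nonneg d
  linarith

/-- `0 < (1+d)^{(4m₀)⁻¹}`. [folklore] -/
theorem rpow_window_pos (m₀ d : ℕ) : 0 < (1 + (d : ℝ)) ^ ((4 * (m₀ : ℝ))⁻¹) :=
  Real.rpow_pos_of_pos (by positivity) _

/-- `((1+d)^{(4m₀)⁻¹})^{4m₀} = 1 + d` (`m₀ ≥ 1`). [folklore] -/
theorem rpow_window_pow (m₀ d : ℕ) (hm : 1 ≤ m₀) :
    ((1 + (d : ℝ)) ^ ((4 * (m₀ : ℝ))⁻¹)) ^ (4 * m₀) = 1 + (d : ℝ) := by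
  have h4 : (4 * (m₀ : ℝ)) = ((4 * m₀ : ℕ) : ℝ) := by push_cast; ring
  rw [h4]
  exact Real.rpow_inv_natCast_pow (by positivity) (by omega)

/-- `((1+d)^{(4m₀)⁻¹})ᵏ ≤ 1 + d` for `k ≤ 4m₀` (`Rᵏ ≤ R^{4m₀}` for `R ≥ 1`). [folklore] -/
theorem rpow_window_pow_le (m₀ d k : ℕ) (hm : 1 ≤ m₀) (hk : k ≤ 4 * m₀) :
    ((1 + (d : ℝ)) ^ ((4 * (m₀ : ℝ))⁻¹)) ^ k ≤ 1 + (d : ℝ) := by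
  calc ((1 + (d : ℝ)) ^ ((4 * (m₀ : ℝ))⁻¹)) ^ k ≤ ((1 + (d : ℝ)) ^ ((4 * (m₀ : ℝ))⁻¹)) ^ (4 * m₀) :=
        pow_le_pow_right₀ (one_le_rpow_window m₀ d) hk
    _ = 1 + (d : ℝ) := rpow_window_pow m₀ d hm

/-- `((1+d)^{(4m₀)⁻¹})ᵏ ≤ (1 + d)ᵏ` for every `k` (crude: `R ≤ R^{4m₀}`). [folklore] -/
theorem rpow_window_pow_le_pow (m₀ d k : ℕ) (hm : 1 ≤ m₀) :
    ((1 + (d : ℝ)) ^ ((4 * (m₀ : ℝ))⁻¹)) ^ k ≤ (1 + (d : ℝ)) ^ k := by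
  refine pow_le_pow_left₀ (rpow_window_pos m₀ d).le ?_ k
  calc (1 + (d : ℝ)) ^ ((4 * (m₀ : ℝ))⁻¹) = ((1 + (d : ℝ)) ^ ((4 * (m₀ : ℝ))⁻¹)) ^ 1 := (pow_one _).symm
    _ ≤ 1 + (d : ℝ) := rpow_window_pow_le m₀ d 1 hm (by omega)

/-! ### The window -/

/-- **The `m₀`-window.** With `A ≥ 1`, `s ≥ 0`, `m₀ ≥ 1`, `d ≥ 1`, `R = (1+d)^{(4m₀)⁻¹}`: if
`s^{4m₀} ≤ ((64A)^{4m₀})⁻¹ (1+d)^{4m₀-1}` then `32 A R s ≤ d` and `s ≤ 1 + d`.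
(`4m₀`-th powers: `(64 A R s)^{4m₀} = (64 A s)^{4m₀} (1+d) ≤ (1+d)^{4m₀-1} (1+d) = (1+d)^{4m₀} ≤ (2d)^{4m₀}`,
so `2 · (32 A R s) ≤ 2 d`; and `s^{4m₀} ≤ (1+d)^{4m₀-1} ≤ (1+d)^{4m₀}`.) [folklore] -/
theorem supWindow_of_pow_le {A s : ℝ} (hA : 1 ≤ A) (hs : 0 ≤ s) {m₀ d : ℕ} (hm : 1 ≤ m₀) (hd : 1 ≤ d)
    (hw : s ^ (4 * m₀) ≤ ((64 * A) ^ (4 * m₀))⁻¹ * (1 + (d : ℝ)) ^ (4 * m₀ - 1)) :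
    32 * A * (1 + (d : ℝ)) ^ ((4 * (m₀ : ℝ))⁻¹) * s ≤ d ∧ s ≤ 1 + (d : ℝ) := by
  set R := (1 + (d : ℝ)) ^ ((4 * (m₀ : ℝ))⁻¹) with hR
  have hd1 : (1 : ℝ) ≤ d := by exact_mod_cast hd
  have hd0 : (0 : ℝ) ≤ d := by linarith
  have hA0 : 0 < A := lt_of_lt_of_le zero_lt_one hA
  have hR0 : 0 ≤ R := (rpow_window_pos m₀ d).le
  have hRn : R ^ (4 * m₀) = 1 + (d : ℝ) := rpow_window_pow m₀ d hm
  have hn0 : (4 * m₀ : ℕ) ≠ 0 := by omega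
  have h1n : 1 ≤ 4 * m₀ := by omega
  have h1d : (0 : ℝ) < 1 + d := by linarith
  have hK : (0 : ℝ) < (64 * A) ^ (4 * m₀) := by positivity
  -- `(64 A s)^{4m₀} ≤ (1+d)^{4m₀-1}`
  have h64 : (64 * A * s) ^ (4 * m₀) ≤ (1 + (d : ℝ)) ^ (4 * m₀ - 1) := by
    have h := mul_le_mul_of_nonneg_left hw hK.le
    rw [← mul_assoc, mul_inv_cancel₀ hK.ne', one_mul] at h
    rw [mul_pow]
    exact h
  constructor
  · -- compare `4m₀`-th powers of `2 · (32 A R s)` and `2 d`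
    have hlhs0 : 0 ≤ 2 * (32 * A * R * s) := by positivity
    have key : (2 * (32 * A * R * s)) ^ (4 * m₀) ≤ (2 * (d : ℝ)) ^ (4 * m₀) := by
      calc (2 * (32 * A * R * s)) ^ (4 * m₀) = ((64 * A * s) * R) ^ (4 * m₀) := by
            congr 1; ring
        _ = (64 * A * s) ^ (4 * m₀) * (1 + (d : ℝ)) := by rw [mul_pow, hRn]
        _ ≤ (1 + (d : ℝ)) ^ (4 * m₀ - 1) * (1 + (d : ℝ)) := mul_le_mul_of_nonneg_right h64 h1d.le
        _ = (1 + (d : ℝ)) ^ (4 * m₀) := by rw [← pow_succ, Nat.sub_add_cancel h1n]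
        _ ≤ (2 * (d : ℝ)) ^ (4 * m₀) := pow_le_pow_left₀ h1d.le (by linarith) _
    have h2 : 2 * (32 * A * R * s) ≤ 2 * (d : ℝ) := (pow_le_pow_iff_left₀ hlhs0 (by positivity) hn0).1 key
    linarith
  · -- `s^{4m₀} ≤ (1+d)^{4m₀-1} ≤ (1+d)^{4m₀}`
    have ha1 : ((64 * A) ^ (4 * m₀))⁻¹ ≤ (1 : ℝ) :=
      inv_le_one_of_one_le₀ (one_le_pow₀ (by linarith))
    have h1 : s ^ (4 * m₀) ≤ (1 + (d : ℝ)) ^ (4 * m₀) := by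
      calc s ^ (4 * m₀) ≤ ((64 * A) ^ (4 * m₀))⁻¹ * (1 + (d : ℝ)) ^ (4 * m₀ - 1) := hw
        _ ≤ 1 * (1 + (d : ℝ)) ^ (4 * m₀ - 1) := mul_le_mul_of_nonneg_right ha1 (by positivity)
        _ ≤ (1 + (d : ℝ)) ^ (4 * m₀) := by
            rw [one_mul]
            exact pow_le_pow_right₀ (by linarith) (Nat.sub_le _ _)
    exact (pow_le_pow_iff_left₀ hs h1d.le hn0).1 h1

/-! ### The Markov factor at cap `E = lam R⁴/4` -/

/-- `(R⁴)^{8m₀} = (1+d)⁸` for `R = (1+d)^{(4m₀)⁻¹}`, `m₀ ≥ 1`. [folklore] -/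
theorem rpow_window_pow_four_pow (m₀ d : ℕ) (hm : 1 ≤ m₀) :
    (((1 + (d : ℝ)) ^ ((4 * (m₀ : ℝ))⁻¹)) ^ 4) ^ (8 * m₀) = (1 + (d : ℝ)) ^ 8 := by
  rw [← pow_mul, show 4 * (8 * m₀) = (4 * m₀) * 8 by ring, pow_mul, rpow_window_pow m₀ d hm]

/-- `(2/E)^{8m₀} = (8/lam)^{8m₀} / (1+d)⁸` at `E = lam R⁴/4`, `R = (1+d)^{(4m₀)⁻¹}` (`lam > 0`, `m₀ ≥ 1`). [folklore] -/
theorem tail_pow_eight_mul_eq {lam : ℝ} (hl : 0 < lam) (m₀ d : ℕ) (hm : 1 ≤ m₀) :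
    (2 / (lam * ((1 + (d : ℝ)) ^ ((4 * (m₀ : ℝ))⁻¹)) ^ 4 / 4)) ^ (8 * m₀) = (8 / lam) ^ (8 * m₀) / (1 + (d : ℝ)) ^ 8 := by
  set R := (1 + (d : ℝ)) ^ ((4 * (m₀ : ℝ))⁻¹) with hR
  have hR0 : 0 < R := rpow_window_pos m₀ d
  have hR4 : (R ^ 4) ^ (8 * m₀) = (1 + (d : ℝ)) ^ 8 := rpow_window_pow_four_pow m₀ d hm
  have hR4' : R ^ 4 ≠ 0 := pow_ne_zero _ hR0.ne'
  have e : 2 / (lam * R ^ 4 / 4) = (8 / lam) * (R ^ 4)⁻¹ := by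
    field_simp
    ring
  rw [e, mul_pow, inv_pow, hR4]
  exact (div_eq_mul_inv _ _).symm

/-! ### Registered sub-goal of the line (closed form of `supWindow_of_pow_le`) -/

/-- **Sub-goal `stub_floorSupWindow`** (registered on the crux item for this helper file; closed `∀`-form of
`supWindow_of_pow_le`): the `m₀`-window of the second floor program. [folklore] -/
theorem stub_floorSupWindow : ∀ (A s : ℝ), 1 ≤ A → 0 ≤ s → ∀ (m₀ d : ℕ), 1 ≤ m₀ → 1 ≤ d → s ^ (4 * m₀) ≤ ((64 * A) ^ (4 * m₀))⁻¹ * (1 + (d : ℝ)) ^ (4 * m₀ - 1) → 32 * A * (1 + (d : ℝ)) ^ ((4 * (m₀ : ℝ))⁻¹) * s ≤ d ∧ s ≤ 1 + (d : ℝ) :=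
  fun _ _ hA hs _ _ hm hd hw => supWindow_of_pow_le hA hs hm hd hw

end Summit.AtomisticToContinuum.FouriersLaw.Theorems.OddSectorIrreversibility.TapLeak

end
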